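import Summits.QuantumFields.YangMills.Theorems.BalabanLadderNTClassicalShadowOrbitSoftClosure
import HarnessLib

/-!
# Crux `NT` (stmt-QuantumFields-19353), stub `stub_refpkgT : RefPkgT`: THE CLASSICAL SHADOW, XVII — the δ-robust orbit test made CONCRETE for the
# two-element swap family: every abstract hypothesis (kernel symmetry, closure, gauge normalisation) discharged from the tree

Helper file (`--supports stmt-QuantumFields-19353`) of the fleet lead prover of crux `NT` (unit `ym-spine-19353-p1`, GEN 16); sequel of
`…ClassicalShadowOrbitSoftClosure` (this generation) and of GEN 14's exact swap test `…TwoValley` (`contrast_le_of_e2osc_swapValley`, p599572).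

WHY.  The δ-robust chain (`orbitCov_le_of_e2osc_nearOrbit`, `zeroTempCovFloorUnbounded_of_nearOrbit`) is stated for an ABSTRACT finite family `γ`
with three structural hypotheses.  This file instantiates it on the simplest symmetry the tree supplies — the coordinate swap `i ↔ j` of a box whose
base and exterior are swap-invariant (`c ∘ swap = c`, `relabelConfig (edgePerm swap) η = η`) — with the family `{id, relabelConfig (edgePerm swap)}`
indexed by `Bool`, and discharges ALL structural hypotheses from tree lemmas (`BoundaryLaw.kerE_perm`, `relabelConfig_swap_swap`,
`relabelConfig_edgePerm_gaugeTransformZd`, `dens_swap`).  What is left is exactly the checkable input: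

* **`contrast_le_of_e2osc_swapValley_soft`** — clause 2 (depth `≥ 1`, unit `a → 0`, `ℓ > 0`, constant `C₂`), a swap-symmetric box, ANY configuration
  `A` with corner densities `p = dens_x(A)`, `q = dens_{x∘swap}(A)`, and the DICHOTOMY «every ground state has `(dens_x, dens_{x∘swap})` within `δ` of
  `(p, q)` or of `(q, p)`» ⇒ **`(p − q)²/4 − 24N·δ ≤ C₂ / min(d_x, d_{x∘swap})⁴ / (1 + ‖x∘swap − x‖)⁴`** (GEN 14's exact test is `δ = 0` with the
  dichotomy an equality);
* **`zeroTempCovFloorUnbounded_of_swapValleys_soft`** — a family of swap-symmetric boxes with dichotomies `δ_b` and contrasts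
  `(p_b − q_b)²/4 > c₀ + 24N·δ_b` at unbounded separation `‖x_b∘swap − x_b‖` ⇒ `ZeroTempCovFloorUnbounded G r` ⇒ `¬` clause 2 at `(G, r)` for every unit.

HONEST FRAMING.  Consequences of the registered clause at fixed lattice geometry; the dichotomy is a HYPOTHESIS (the variational input); nothing here
asserts that such boxes exist; no floor, not AF, not NT, not the seam, not the gap; not Clay.
-/

set_option autoImplicit false

noncomputable section

open MeasureTheory Filter Topology
open Literature.MathematicalPhysics.QuantumFieldTheory Literature.MathematicalPhysics.QuantumLattice
open Literature.Probability.LatticeModels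
open Summit.QuantumFields.YangMills.Cruxes.OSLegsFromFemtoAndGap.DlrCollarTransfer
open Summit.QuantumFields.YangMills.Cruxes.UVSeamRec.BoundaryLawPenetration

namespace Summit.QuantumFields.YangMills.Cruxes.NT.ClassicalShadow

variable {G : Type} [Group G] [TopologicalSpace G] [IsTopologicalGroup G] [CompactSpace G]
  [MeasurableSpace G] [BorelSpace G] (r : LatticeRep G)

/-! ## §1 The swap family `{id, relabelConfig (edgePerm (swap i j))}` and its three structural properties -/

section SwapFamily

variable (i j : Fin 4)

omit [TopologicalSpace G] [IsTopologicalGroup G] [CompactSpace G] [MeasurableSpace G] [BorelSpace G] in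
/-- The trivial gauge transformation acts trivially. [folklore] -/
theorem gaugeTransformZd_one_eq (U : LGConfig 4 G) : gaugeTransformZd (fun _ : Site 4 => (1 : G)) U = U := by
  funext e
  simp [gaugeTransformZd]

omit [TopologicalSpace G] [IsTopologicalGroup G] [CompactSpace G] [MeasurableSpace G] [BorelSpace G] in
/-- `(x ∘ swap) ∘ swap = x`. [folklore] -/
theorem comp_swap_comp_swap (x : Fin 4 → ℤ) : (x ∘ Equiv.swap i j) ∘ Equiv.swap i j = x := by
  funext k
  simp only [Function.comp_apply, Equiv.swap_apply_self]

omit [Group G] [IsTopologicalGroup G] [CompactSpace G] [BorelSpace G] in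
/-- Both members of the swap family are continuous. [folklore] -/
theorem continuous_swapFamily (s : Bool) :
    Continuous ((fun (s : Bool) (U : LGConfig 4 G) => cond s (relabelConfig (edgePerm (Equiv.swap i j)) U) U) s) := by
  cases s
  · exact continuous_id
  · show Continuous fun U : LGConfig 4 G => relabelConfig (edgePerm (Equiv.swap i j)) U
    refine continuous_pi fun e => ?_
    simp only [relabelConfig_apply]
    exact continuous_apply _

omit [TopologicalSpace G] [IsTopologicalGroup G] [CompactSpace G] [BorelSpace G] in
/-- **Closure**: the swap family is closed under composition (exactly; gauge factor `1`), re-indexing by `id` resp. `not`. [folklore] -/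
theorem swapFamily_mul (j' : Bool) : ∃ e : Bool ≃ Bool, ∀ (k : Bool) (U : LGConfig 4 G), ∃ h : Site 4 → G,
    (fun (s : Bool) (U : LGConfig 4 G) => cond s (relabelConfig (edgePerm (Equiv.swap i j)) U) U) k
        ((fun (s : Bool) (U : LGConfig 4 G) => cond s (relabelConfig (edgePerm (Equiv.swap i j)) U) U) j' U) =
      gaugeTransformZd h ((fun (s : Bool) (U : LGConfig 4 G) => cond s (relabelConfig (edgePerm (Equiv.swap i j)) U) U) (e k) U) := by
  cases j'
  · refine ⟨Equiv.refl Bool, fun k U => ⟨fun _ => 1, ?_⟩⟩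
    rw [gaugeTransformZd_one_eq]
    rfl
  · refine ⟨Equiv.boolNot, fun k U => ⟨fun _ => 1, ?_⟩⟩
    rw [gaugeTransformZd_one_eq]
    cases k
    · rfl
    · show relabelConfig (edgePerm (Equiv.swap i j)) (relabelConfig (edgePerm (Equiv.swap i j)) U) = U
      exact relabelConfig_swap_swap i j U

omit [TopologicalSpace G] [IsTopologicalGroup G] [CompactSpace G] [BorelSpace G] in
/-- **Gauge normalisation** of the swap family. [folklore] -/
theorem swapFamily_gauge (s : Bool) (g : Site 4 → G) : ∃ g' : Site 4 → G, ∀ U : LGConfig 4 G,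
    (fun (s : Bool) (U : LGConfig 4 G) => cond s (relabelConfig (edgePerm (Equiv.swap i j)) U) U) s (gaugeTransformZd g U) =
      gaugeTransformZd g' ((fun (s : Bool) (U : LGConfig 4 G) => cond s (relabelConfig (edgePerm (Equiv.swap i j)) U) U) s U) := by
  cases s
  · exact ⟨g, fun U => rfl⟩
  · exact ⟨g ∘ sitePerm (Equiv.swap i j).symm, fun U => relabelConfig_edgePerm_gaugeTransformZd (Equiv.swap i j) g U⟩

/-- **Kernel symmetry** of the swap family for a swap-invariant box `(c, η)`, on every observable. [folklore] -/
theorem swapFamily_symm {c : Fin 4 → ℤ} (hc : c ∘ Equiv.swap i j = c) (b : ℕ) {η : LGConfig 4 G}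
    (hη : relabelConfig (edgePerm (Equiv.swap i j)) η = η) (β : ℝ) (s : Bool) (F : LGConfig 4 G → ℝ) :
    kerE G r β c b η (F ∘ (fun (s : Bool) (U : LGConfig 4 G) => cond s (relabelConfig (edgePerm (Equiv.swap i j)) U) U) s) =
      kerE G r β c b η F := by
  cases s
  · rfl
  · have hc' : sitePerm (Equiv.swap i j) c = c := by
      funext k; rw [sitePerm_apply, Equiv.symm_swap]; exact congrFun hc k
    have h := Summit.QuantumFields.YangMills.Cruxes.NT.BoundaryLaw.kerE_perm G r (Equiv.swap i j) β c b η F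
    rw [hc', hη] at h
    exact h.symm

/-- **The dichotomy gives the family-form near-orbit hypothesis** (witness `j = false` for the `(p, q)` branch, `true` for `(q, p)`; gauge factor `1`).
[folklore] -/
theorem swapFamily_near (c : Fin 4 → ℤ) (b : ℕ) (η : LGConfig 4 G) (A : LGConfig 4 G) (x : Fin 4 → ℤ) {δ : ℝ}
    (hGS : ∀ ζ ∈ cubeMinimisers G r c b η,
      (|dens G r x (glueWith (cubeEdges c b) ζ η) - dens G r x A| ≤ δ ∧
        |dens G r (x ∘ Equiv.swap i j) (glueWith (cubeEdges c b) ζ η) - dens G r (x ∘ Equiv.swap i j) A| ≤ δ) ∨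
      (|dens G r x (glueWith (cubeEdges c b) ζ η) - dens G r (x ∘ Equiv.swap i j) A| ≤ δ ∧
        |dens G r (x ∘ Equiv.swap i j) (glueWith (cubeEdges c b) ζ η) - dens G r x A| ≤ δ)) :
    ∀ ζ ∈ cubeMinimisers G r c b η, ∃ (j' : Bool) (g : Site 4 → G), ∀ s : Bool,
      |dens G r x ((fun (s : Bool) (U : LGConfig 4 G) => cond s (relabelConfig (edgePerm (Equiv.swap i j)) U) U) s
            (glueWith (cubeEdges c b) ζ η)) -
          dens G r x ((fun (s : Bool) (U : LGConfig 4 G) => cond s (relabelConfig (edgePerm (Equiv.swap i j)) U) U) s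
            (gaugeTransformZd g ((fun (s : Bool) (U : LGConfig 4 G) => cond s (relabelConfig (edgePerm (Equiv.swap i j)) U) U) j' A)))| ≤ δ ∧
      |dens G r (x ∘ Equiv.swap i j) ((fun (s : Bool) (U : LGConfig 4 G) => cond s (relabelConfig (edgePerm (Equiv.swap i j)) U) U) s
            (glueWith (cubeEdges c b) ζ η)) -
          dens G r (x ∘ Equiv.swap i j) ((fun (s : Bool) (U : LGConfig 4 G) => cond s (relabelConfig (edgePerm (Equiv.swap i j)) U) U) s
            (gaugeTransformZd g ((fun (s : Bool) (U : LGConfig 4 G) => cond s (relabelConfig (edgePerm (Equiv.swap i j)) U) U) j' A)))| ≤ δ := by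
  intro ζ hζ
  have hxx := comp_swap_comp_swap i j x
  rcases hGS ζ hζ with ⟨h1, h2⟩ | ⟨h1, h2⟩
  · refine ⟨false, fun _ => 1, fun s => ?_⟩
    rw [gaugeTransformZd_one_eq]
    cases s
    · exact ⟨h1, h2⟩
    · simp only [cond_true, dens_swap, hxx]
      exact ⟨h2, h1⟩
  · refine ⟨true, fun _ => 1, fun s => ?_⟩
    rw [gaugeTransformZd_one_eq]
    cases s
    · simp only [cond_false, cond_true, dens_swap, hxx]
      exact ⟨h1, h2⟩
    · simp only [cond_true, dens_swap, hxx, relabelConfig_swap_swap]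
      exact ⟨h2, h1⟩

/-- The orbit covariance of the swap family at `(x, x∘swap)` is minus a quarter of the squared contrast. [folklore] -/
theorem swapFamily_orbitCov (A : LGConfig 4 G) (x : Fin 4 → ℤ) :
    (∑ s : Bool, dens G r x ((fun (s : Bool) (U : LGConfig 4 G) => cond s (relabelConfig (edgePerm (Equiv.swap i j)) U) U) s A) *
          dens G r (x ∘ Equiv.swap i j) ((fun (s : Bool) (U : LGConfig 4 G) => cond s (relabelConfig (edgePerm (Equiv.swap i j)) U) U) s A)) /
        Fintype.card Bool -
      (∑ s : Bool, dens G r x ((fun (s : Bool) (U : LGConfig 4 G) => cond s (relabelConfig (edgePerm (Equiv.swap i j)) U) U) s A)) /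
          Fintype.card Bool *
        ((∑ s : Bool, dens G r (x ∘ Equiv.swap i j)
            ((fun (s : Bool) (U : LGConfig 4 G) => cond s (relabelConfig (edgePerm (Equiv.swap i j)) U) U) s A)) / Fintype.card Bool) =
      -((dens G r x A - dens G r (x ∘ Equiv.swap i j) A) ^ 2 / 4) := by
  simp only [Fintype.sum_bool, cond_true, cond_false, dens_swap, comp_swap_comp_swap, Fintype.card_bool, Nat.cast_ofNat]
  ring

end SwapFamily

/-! ## §2 The δ-robust swap test and its kill-path feed -/

section SwapTest

variable (a : ℝ → ℝ)

/-- **δ-robust two-valley swap test.**  Clause 2 of the registered package (depth `≥ 1`, unit `a → 0`, `ℓ > 0`, constant `C₂`), a box `(c, b)` and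
exterior `η` invariant under the coordinate swap `i ↔ j`, a configuration `A` with `p = dens_x(A)`, `q = dens_{x∘swap}(A)`, and the dichotomy
«every ground state has `(dens_x, dens_{x∘swap})` within `δ` of `(p, q)` or of `(q, p)`» ⇒
`(p − q)²/4 − 24N·δ ≤ C₂ / min(d_x, d_{x∘swap})⁴ / (1 + ‖x∘swap − x‖)⁴`. [folklore] -/
theorem contrast_le_of_e2osc_swapValley_soft (ha0 : Tendsto a atTop (𝓝 0)) {C₂ ℓ : ℝ} (hℓ : 0 < ℓ)
    (hE2 : ∃ β₂ : ℝ, ∀ β : ℝ, β₂ ≤ β → ∀ (c : Fin 4 → ℤ) (b : ℕ), (b : ℝ) * a β ≤ ℓ →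
      ∀ (η η' : LGConfig 4 G) (x y : Fin 4 → ℤ), 1 ≤ depth c b x → 1 ≤ depth c b y →
        |kerCov G r β c b η (dens G r x) (dens G r y) - kerCov G r β c b η' (dens G r x) (dens G r y)| ≤
          C₂ / ((min (depth c b x) (depth c b y) : ℕ) : ℝ) ^ 4 / (1 + ‖siteToE (y - x)‖) ^ 4)
    (i j : Fin 4) {c : Fin 4 → ℤ} (hc : c ∘ Equiv.swap i j = c) (b : ℕ) {η : LGConfig 4 G}
    (hη : relabelConfig (edgePerm (Equiv.swap i j)) η = η) (A : LGConfig 4 G) {x : Fin 4 → ℤ}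
    (hx : 1 ≤ depth c b x) (hy : 1 ≤ depth c b (x ∘ Equiv.swap i j)) {δ : ℝ}
    (hGS : ∀ ζ ∈ cubeMinimisers G r c b η,
      (|dens G r x (glueWith (cubeEdges c b) ζ η) - dens G r x A| ≤ δ ∧
        |dens G r (x ∘ Equiv.swap i j) (glueWith (cubeEdges c b) ζ η) - dens G r (x ∘ Equiv.swap i j) A| ≤ δ) ∨
      (|dens G r x (glueWith (cubeEdges c b) ζ η) - dens G r (x ∘ Equiv.swap i j) A| ≤ δ ∧
        |dens G r (x ∘ Equiv.swap i j) (glueWith (cubeEdges c b) ζ η) - dens G r x A| ≤ δ)) :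
    (dens G r x A - dens G r (x ∘ Equiv.swap i j) A) ^ 2 / 4 - 24 * r.N * δ ≤
      C₂ / ((min (depth c b x) (depth c b (x ∘ Equiv.swap i j)) : ℕ) : ℝ) ^ 4 / (1 + ‖siteToE (x ∘ Equiv.swap i j - x)‖) ^ 4 := by
  have h := orbitCov_le_of_e2osc_nearOrbit r a ha0 hℓ hE2 c b η
    (fun (s : Bool) (U : LGConfig 4 G) => cond s (relabelConfig (edgePerm (Equiv.swap i j)) U) U)
    (continuous_swapFamily i j) (swapFamily_mul i j) (swapFamily_gauge i j)
    (fun β s F _ => swapFamily_symm r i j hc b hη β s F) A hx hy (swapFamily_near r i j c b η A x hGS)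
  rw [swapFamily_orbitCov r i j A x, abs_neg, abs_of_nonneg (by positivity)] at h
  exact h

/-- **Family of δ-robust swap valleys ⇒ unbounded zero-temperature floor ⇒ `¬` clause 2.**  For every `n`: a swap-invariant box and exterior, a
configuration `A`, a cube site `x` (depths of `x`, `x∘swap` `≥ 1`) with `‖x∘swap − x‖ ≥ n`, a tolerance `δ` with the dichotomy, and contrast
`c₀ + 24N·δ < (dens_x(A) − dens_{x∘swap}(A))²/4`.  Then `ZeroTempCovFloorUnbounded G r`. [folklore] -/
theorem zeroTempCovFloorUnbounded_of_swapValleys_soft {c₀ : ℝ} (hc₀ : 0 < c₀)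
    (h : ∀ n : ℕ, ∃ (i j : Fin 4) (c : Fin 4 → ℤ) (b : ℕ) (η : LGConfig 4 G) (A : LGConfig 4 G) (x : Fin 4 → ℤ) (δ : ℝ),
      c ∘ Equiv.swap i j = c ∧ relabelConfig (edgePerm (Equiv.swap i j)) η = η ∧
      1 ≤ depth c b x ∧ 1 ≤ depth c b (x ∘ Equiv.swap i j) ∧ (n : ℝ) ≤ ‖siteToE (x ∘ Equiv.swap i j - x)‖ ∧
      (∀ ζ ∈ cubeMinimisers G r c b η,
        (|dens G r x (glueWith (cubeEdges c b) ζ η) - dens G r x A| ≤ δ ∧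
          |dens G r (x ∘ Equiv.swap i j) (glueWith (cubeEdges c b) ζ η) - dens G r (x ∘ Equiv.swap i j) A| ≤ δ) ∨
        (|dens G r x (glueWith (cubeEdges c b) ζ η) - dens G r (x ∘ Equiv.swap i j) A| ≤ δ ∧
          |dens G r (x ∘ Equiv.swap i j) (glueWith (cubeEdges c b) ζ η) - dens G r x A| ≤ δ)) ∧
      c₀ + 24 * r.N * δ < (dens G r x A - dens G r (x ∘ Equiv.swap i j) A) ^ 2 / 4) :
    ZeroTempCovFloorUnbounded G r := by
  refine zeroTempCovFloorUnbounded_of_nearOrbit (ι := Bool) r hc₀ fun n => ?_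
  obtain ⟨i, j, c, b, η, A, x, δ, hc, hη, hx, hy, hsep, hGS, hgap⟩ := h n
  refine ⟨c, b, η, fun (s : Bool) (U : LGConfig 4 G) => cond s (relabelConfig (edgePerm (Equiv.swap i j)) U) U, A, x,
    x ∘ Equiv.swap i j, δ, continuous_swapFamily i j, swapFamily_mul i j, swapFamily_gauge i j,
    fun β s F _ => swapFamily_symm r i j hc b hη β s F, hx, hy, hsep, swapFamily_near r i j c b η A x hGS, ?_⟩
  rw [swapFamily_orbitCov r i j A x, abs_neg, abs_of_nonneg (by positivity)]
  exact hgap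

end SwapTest

end Summit.QuantumFields.YangMills.Cruxes.NT.ClassicalShadow

end
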